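import Summits.ABC.ABC.Theorems.PrimePowerRadical.Negative.Orders
import Summits.ABC.ABC.Theorems.PrimePowerRadical.Negative.DoubleWall
import Summits.ABC.ABC.Theorems.PrimePowerRadical.Negative.LinearLoss

/-!
# The dial: summable `ord^{-a}`-weighted Wieferich atoms give `log E_W(q,k) ≤ ε·k^a + C`

For a prime `q` and a real `a ≥ 0` write `W_p := wieferichLevel q p`, `d_p := ordMod q p` and
`c_p := (W_p − 1) · log p / d_p ^ a` (real power). We prove (`stub_excess_littleO`): if `Σ_p c_p < ∞`
(sum over the primes `p`), then for every `ε > 0` there is a constant `C` with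
`log E_W(q,k) ≤ ε · k ^ a + C` for all `k ≥ 1`, where `E_W(q,k) = oddWieferichExcess q k` is the odd
Wieferich excess of `q^k − 1`. (`a = 1` is the regime of the lever of the line, up to the shape of the
constant; `a = 0` is "finite total Wieferich mass".)

Proof idea. `log E_W(q,k) = Σ_{p ∈ S} (W_p − 1) log p` over the odd primes `p ∣ q^k − 1`
(a PRIVATE copy `dial_log_oddWieferichExcess_eq` of the sibling stub file's public
`lav_log_oddWieferichExcess_eq` (`…StubPPRAtIffLevelAverage`, same namespace): the six stub files of the
line are kept import-independent for the lead's assembly, and no second global copy is exported).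
Such a `p` does not divide `q`, so `1 ≤ d_p ∣ k`, whence
`(W_p − 1) log p = c_p · d_p ^ a ≤ c_p · k ^ a` (`dial_mass_le_atom_mul`). Summability of the `c_p`
(transported to `ℕ` through the indicator of the primes) gives a finite set `F ⊆ ℕ` off which every
finite sum of the `c_p` is `< ε` (`summable_iff_vanishing_norm`); put `C := Σ_{p ∈ F} (W_p − 1) log p`.
Splitting `S` into `S ∩ F` (contributing `≤ C`, the masses being nonnegative) and `S \ F`
(contributing `≤ k ^ a · ε`) gives the claim. No `M`-splitting is needed here.

Sources: card `adelic-brjuno-summability` (crux stmt-ABC-1648, line `Sketch`); the bookkeeping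
(the indicator transport, the vanishing-norm splitting) is ported from
`Cruxes/PrimePowerRadical/SketchIdeator2g2.lean` (`wieferichSparse_of_wdc`).
Deliberately NOT here: the lever itself (`a = 1` with the constant in the shape `C · q^{εk}`), the
Romanoff-type expectation theorem, and any claim that the weighted sum actually converges.
-/

noncomputable section

-- `Summit.<Summit>.<Problem>` is the mandated summit-side namespace (CONVENTIONS §2); for the
-- single-conjunct summit `ABC` the two coincide, so the duplicate `ABC.ABC` is deliberate.
set_option linter.dupNamespace false

namespace Summit.ABC.ABC.Theorems.PrimePowerRadical.Brjuno

open Literature.NumberTheory.DiophantineGeometry UniqueFactorizationMonoid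
open Summit.ABC.ABC.Theses.IneffectiveSubspace
open Summit.ABC.ABC.Theorems.PrimePowerRadical.Negative
open scoped BigOperators

/-- `log E_W(q,k)` as a sum over the odd primes of `q^k − 1`:
`log E_W(q,k) = Σ_{p ∣ q^k − 1, p ≠ 2} (W_p − 1) · log p`.
(Private: the public copy is `lav_log_oddWieferichExcess_eq` of the sibling stub file
`…StubPPRAtIffLevelAverage` in this namespace; not re-exported here.) -/
private theorem dial_log_oddWieferichExcess_eq (q k : ℕ) :
    Real.log (oddWieferichExcess q k) =
      ∑ p ∈ (q ^ k - 1).primeFactors.erase 2, ((wieferichLevel q p - 1 : ℕ) : ℝ) * Real.log p := by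
  -- adapted from Cruxes/PrimePowerRadical/SketchIdeator2g2.lean (`log_oddWieferichExcess_eq`)
  unfold oddWieferichExcess
  rw [Nat.cast_prod, Real.log_prod]
  · apply Finset.sum_congr rfl
    intro p _
    rw [Nat.cast_pow, Real.log_pow]
  · intro p hp
    have hpr : p.Prime := Nat.prime_of_mem_primeFactors (Finset.mem_of_mem_erase hp)
    exact_mod_cast (pow_pos hpr.pos _).ne'

/-- The Wieferich mass `(W_p − 1) · log p` of a natural number `p` is nonnegative. -/
private theorem dial_mass_nonneg (q p : ℕ) :
    0 ≤ ((wieferichLevel q p - 1 : ℕ) : ℝ) * Real.log p :=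
  mul_nonneg (Nat.cast_nonneg _) (Real.log_natCast_nonneg p)

/-- The weighted atom `(W_p − 1) · log p / d_p ^ a` is nonnegative. -/
private theorem dial_atom_nonneg (q p : ℕ) (a : ℝ) :
    0 ≤ ((wieferichLevel q p - 1 : ℕ) : ℝ) * Real.log p / (ordMod q p : ℝ) ^ a :=
  div_nonneg (dial_mass_nonneg q p) (Real.rpow_nonneg (Nat.cast_nonneg _) a)

/-- For a prime `p ∣ q^k − 1` (`q, k ≥ 1`) and `a ≥ 0`: the mass `(W_p − 1) · log p` is at most the
weighted atom times `k ^ a`, because `1 ≤ d_p ∣ k`. -/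
theorem dial_mass_le_atom_mul {q k p : ℕ} {a : ℝ} (ha : 0 ≤ a) (hq : 1 ≤ q) (hk : 1 ≤ k)
    (hp : p.Prime) (hpk : p ∣ q ^ k - 1) :
    ((wieferichLevel q p - 1 : ℕ) : ℝ) * Real.log p ≤
      ((wieferichLevel q p - 1 : ℕ) : ℝ) * Real.log p / (ordMod q p : ℝ) ^ a * (k : ℝ) ^ a := by
  have hpq : ¬ p ∣ q := not_dvd_base_of_dvd hp hk hq hpk
  have hd : 0 < ordMod q p := ordMod_pos hp hpq
  have hdk : ordMod q p ≤ k :=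
    Nat.le_of_dvd (by omega) ((dvd_pow_sub_one_iff_ordMod_dvd hp hq k).mp hpk)
  have hdR : (0 : ℝ) < (ordMod q p : ℝ) := by exact_mod_cast hd
  have hda : (0 : ℝ) < (ordMod q p : ℝ) ^ a := Real.rpow_pos_of_pos hdR a
  have hle : (ordMod q p : ℝ) ^ a ≤ (k : ℝ) ^ a :=
    Real.rpow_le_rpow hdR.le (by exact_mod_cast hdk) ha
  calc ((wieferichLevel q p - 1 : ℕ) : ℝ) * Real.log p
      = ((wieferichLevel q p - 1 : ℕ) : ℝ) * Real.log p / (ordMod q p : ℝ) ^ a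
          * (ordMod q p : ℝ) ^ a := by
        rw [div_mul_cancel₀ _ hda.ne']
    _ ≤ ((wieferichLevel q p - 1 : ℕ) : ℝ) * Real.log p / (ordMod q p : ℝ) ^ a * (k : ℝ) ^ a :=
        mul_le_mul_of_nonneg_left hle (dial_atom_nonneg q p a)

/-- **The dial.** For a prime `q` and `a ≥ 0`: if the `ord^{-a}`-weighted Wieferich atoms are summable over
the primes, `Σ_p (W_p − 1) · log p / ord_p(q) ^ a < ∞`, then for every `ε > 0` there is `C` with
`log E_W(q,k) ≤ ε · k ^ a + C` for all `k ≥ 1`. -/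
theorem stub_excess_littleO {q : ℕ} (hq : q.Prime) {a : ℝ} (ha : 0 ≤ a)
    (h : Summable (fun p : Nat.Primes =>
      ((wieferichLevel q p - 1 : ℕ) : ℝ) * Real.log p / (ordMod q p : ℝ) ^ a)) :
    ∀ ε : ℝ, 0 < ε → ∃ C : ℝ, ∀ k : ℕ, 1 ≤ k →
      Real.log (oddWieferichExcess q k) ≤ ε * (k : ℝ) ^ a + C := by
  have hq1 : 1 ≤ q := hq.one_lt.le
  -- the weighted atom as a function on `ℕ`, transported through the indicator of the primes
  set c : ℕ → ℝ := fun p =>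
    ((wieferichLevel q p - 1 : ℕ) : ℝ) * Real.log p / (ordMod q p : ℝ) ^ a
  have hGsum : Summable ((setOf Nat.Prime).indicator c) := summable_subtype_iff_indicator.mp h
  have hGp : ∀ p : ℕ, p.Prime → (setOf Nat.Prime).indicator c p = c p := fun p hp =>
    Set.indicator_of_mem (show p ∈ setOf Nat.Prime from hp) _
  intro ε hε
  -- vanishing set `F` for `ε`, and the constant `C := Σ_{p ∈ F} (W_p − 1) log p`
  obtain ⟨F, hF⟩ := summable_iff_vanishing_norm.mp hGsum ε hε
  refine ⟨∑ p ∈ F, ((wieferichLevel q p - 1 : ℕ) : ℝ) * Real.log p, fun k hk => ?_⟩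
  rw [dial_log_oddWieferichExcess_eq]
  set S := (q ^ k - 1).primeFactors.erase 2
  have hmemS : ∀ p ∈ S, p.Prime ∧ p ∣ q ^ k - 1 := by
    intro p hp
    have hpP := Finset.mem_of_mem_erase hp
    exact ⟨Nat.prime_of_mem_primeFactors hpP, Nat.dvd_of_mem_primeFactors hpP⟩
  rw [← Finset.sum_filter_add_sum_filter_not S (fun p => p ∈ F)]
  -- the `F`-part is bounded by the constant
  have hB1 : ∑ p ∈ S.filter (fun p => p ∈ F), ((wieferichLevel q p - 1 : ℕ) : ℝ) * Real.log p ≤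
      ∑ p ∈ F, ((wieferichLevel q p - 1 : ℕ) : ℝ) * Real.log p := by
    apply Finset.sum_le_sum_of_subset_of_nonneg
    · intro p hp
      exact (Finset.mem_filter.mp hp).2
    · intro p _ _
      exact dial_mass_nonneg q p
  -- the part off `F` is bounded by `ε · k ^ a`
  have hdisj : Disjoint (S.filter (fun p => ¬ p ∈ F)) F := by
    rw [Finset.disjoint_left]
    intro p hp2 hpF
    exact (Finset.mem_filter.mp hp2).2 hpF
  have hB2 : ∑ p ∈ S.filter (fun p => ¬ p ∈ F), ((wieferichLevel q p - 1 : ℕ) : ℝ) * Real.log p ≤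
      ε * (k : ℝ) ^ a := by
    have h1 : ∑ p ∈ S.filter (fun p => ¬ p ∈ F), ((wieferichLevel q p - 1 : ℕ) : ℝ) * Real.log p ≤
        ∑ p ∈ S.filter (fun p => ¬ p ∈ F), c p * (k : ℝ) ^ a := by
      apply Finset.sum_le_sum
      intro p hp
      obtain ⟨hpr, hpk⟩ := hmemS p (Finset.mem_filter.mp hp).1
      exact dial_mass_le_atom_mul ha hq1 hk hpr hpk
    have h2 : ∑ p ∈ S.filter (fun p => ¬ p ∈ F), c p * (k : ℝ) ^ a =
        (k : ℝ) ^ a * ∑ p ∈ S.filter (fun p => ¬ p ∈ F), (setOf Nat.Prime).indicator c p := by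
      rw [Finset.mul_sum]
      apply Finset.sum_congr rfl
      intro p hp
      rw [hGp p (hmemS p (Finset.mem_filter.mp hp).1).1]
      ring
    have h3 : ∑ p ∈ S.filter (fun p => ¬ p ∈ F), (setOf Nat.Prime).indicator c p ≤ ε := by
      have h4 := hF _ hdisj
      rw [Real.norm_eq_abs] at h4
      exact (abs_lt.mp h4).2.le
    have hka : (0 : ℝ) ≤ (k : ℝ) ^ a := Real.rpow_nonneg (Nat.cast_nonneg _) a
    calc ∑ p ∈ S.filter (fun p => ¬ p ∈ F), ((wieferichLevel q p - 1 : ℕ) : ℝ) * Real.log p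
        ≤ ∑ p ∈ S.filter (fun p => ¬ p ∈ F), c p * (k : ℝ) ^ a := h1
      _ = (k : ℝ) ^ a * ∑ p ∈ S.filter (fun p => ¬ p ∈ F), (setOf Nat.Prime).indicator c p := h2
      _ ≤ (k : ℝ) ^ a * ε := mul_le_mul_of_nonneg_left h3 hka
      _ = ε * (k : ℝ) ^ a := mul_comm _ _
  linarith

end Summit.ABC.ABC.Theorems.PrimePowerRadical.Brjuno

end
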